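import Summits.Ventures.Crystal3D.Theorems.StickyWulffConstantCoaxialWallLawOnSiteLocality
import Summits.Ventures.Crystal3D.Theorems.StickyWulffConstantGenericWallFloorCredits
import Summits.Ventures.Crystal3D.Theorems.StickyWulffConstantGenericWallFloorMixedDozenRules
import HarnessLib

/-!
# Saturated readers: a FULL or TWIN-DOZEN reader is touched only by its own twelve reading balls
# (crux `CoaxialWallLaw`, stmt-Ventures-19481, line `WallLedgerF`; census-free brick for the NON-BARLOW tail)

HONEST FRAMING. Venture `Summits/Ventures/Crystal3D` (cell `crystal3d-full`), helper `--supports` the crux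
`CoaxialWallLaw` (stmt-Ventures-19481, `route-Ventures-StickyWulffConstant`), REGISTERED line `WallLedgerF` (planner
cf-p1, decision (lvi): «GO on the non-Barlow bricks (cage lemma, saturated readers)»).  Rung credit; F-C1 not moved.

In a `1`-separated configuration `X` (kissing number twelve, `card_filter_dist_eq_one_le_twelve`):
* `contacts_eq_of_isFull` — a FULL reader `b` (all twelve `b + G w ∈ X`) has contact set EXACTLY `{b + G w}`;
  `card_contacts_of_isFull` (`= 12`), `mem_frame_of_contact_of_isFull` (no foreign contact), `not_payer_of_isFull`
  (`¬ #contacts ≤ 11`);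
* `card_twinNeg_eq_card_twinPos`, `card_twinDozen` — for ANY unit `m`, the closed lower `G`-half-shell together with the
  mirror images of the open lower half-shell has twelve members (the antipody `w ↦ −w` of the slot set balances the signs);
* `contacts_eq_of_isTwinReading` — a TWIN-DOZEN reader `(G, m)` at `b` has contact set EXACTLY that twin dozen;
  `card_contacts_of_isTwinReading`, `mem_twinDozen_of_contact_of_isTwinReading`, `not_payer_of_isTwinReading`.
So foreign balls never touch FULL or TWIN readers: in the end-row automaton a foreign contact can only sit on a ball that
already has a vacant reading (memo HOME/wall-19481-p2/F-TAIL-g8.md §4; companion of `…CoaxialWallLawKissingCage`).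
WHAT THIS IS NOT: not the tail; F-C1 not moved.
-/

noncomputable section

namespace Summit.Ventures.Crystal3D.Theorems

open Summit.Ventures.Crystal3D Finset NearIdentity
open scoped InnerProductSpace

variable {X : Finset (EuclideanSpace ℝ (Fin 3))}

/-! ### FULL readers -/

/-- The frame balls `b + G w` are twelve. -/
theorem card_image_frame (G : EuclideanSpace ℝ (Fin 3) ≃ₗᵢ[ℝ] EuclideanSpace ℝ (Fin 3)) (b : EuclideanSpace ℝ (Fin 3)) :
    (fccSlots.image fun w => b + G w).card = 12 := by
  classical
  rw [Finset.card_image_of_injective _ (fun w w' h => G.injective (add_left_cancel h)), card_fccSlots]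

/-- **A FULL reader is touched exactly by its twelve reading balls.** -/
theorem contacts_eq_of_isFull (hX : ∀ p ∈ X, ∀ q ∈ X, p ≠ q → 1 ≤ dist p q)
    {G : EuclideanSpace ℝ (Fin 3) ≃ₗᵢ[ℝ] EuclideanSpace ℝ (Fin 3)} {b : EuclideanSpace ℝ (Fin 3)} (h : IsFull X G b) :
    (X.filter fun q => dist b q = 1) = fccSlots.image fun w => b + G w := by
  classical
  symm
  apply Finset.eq_of_subset_of_card_le
  · intro x hx
    obtain ⟨w, hw, rfl⟩ := Finset.mem_image.1 hx
    refine Finset.mem_filter.2 ⟨h w hw, ?_⟩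
    rw [dist_eq_norm, show b - (b + G w) = -(G w) by abel, norm_neg, LinearIsometryEquiv.norm_map,
      norm_eq_one_of_mem_fccSlots hw]
  · rw [card_image_frame]
    exact card_filter_dist_eq_one_le_twelve X hX b

/-- A FULL reader has exactly twelve contacts. -/
theorem card_contacts_of_isFull (hX : ∀ p ∈ X, ∀ q ∈ X, p ≠ q → 1 ≤ dist p q)
    {G : EuclideanSpace ℝ (Fin 3) ≃ₗᵢ[ℝ] EuclideanSpace ℝ (Fin 3)} {b : EuclideanSpace ℝ (Fin 3)} (h : IsFull X G b) :
    (X.filter fun q => dist b q = 1).card = 12 := by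
  rw [contacts_eq_of_isFull hX h, card_image_frame]

/-- **No foreign contact at a FULL reader**: every ball of `X` touching `b` is a reading ball `b + G w`. -/
theorem mem_frame_of_contact_of_isFull (hX : ∀ p ∈ X, ∀ q ∈ X, p ≠ q → 1 ≤ dist p q)
    {G : EuclideanSpace ℝ (Fin 3) ≃ₗᵢ[ℝ] EuclideanSpace ℝ (Fin 3)} {b : EuclideanSpace ℝ (Fin 3)} (h : IsFull X G b)
    {x : EuclideanSpace ℝ (Fin 3)} (hx : x ∈ X) (hd : dist b x = 1) : ∃ w ∈ fccSlots, x = b + G w := by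
  classical
  have hx' : x ∈ X.filter fun q => dist b q = 1 := Finset.mem_filter.2 ⟨hx, hd⟩
  rw [contacts_eq_of_isFull hX h] at hx'
  obtain ⟨w, hw, hwx⟩ := Finset.mem_image.1 hx'
  exact ⟨w, hw, hwx.symm⟩

/-- A FULL reader is not a payer (`#contacts ≤ 11` fails). -/
theorem not_payer_of_isFull (hX : ∀ p ∈ X, ∀ q ∈ X, p ≠ q → 1 ≤ dist p q)
    {G : EuclideanSpace ℝ (Fin 3) ≃ₗᵢ[ℝ] EuclideanSpace ℝ (Fin 3)} {b : EuclideanSpace ℝ (Fin 3)} (h : IsFull X G b) :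
    ¬ (X.filter fun q => dist b q = 1).card ≤ 11 := by
  rw [card_contacts_of_isFull hX h]; norm_num

/-! ### TWIN-DOZEN readers -/

/-- Sign balance: the slots reading negative against `m` are as many as those reading positive (`w ↦ −w`). -/
theorem card_twinNeg_eq_card_twinPos (G : EuclideanSpace ℝ (Fin 3) ≃ₗᵢ[ℝ] EuclideanSpace ℝ (Fin 3))
    (m : EuclideanSpace ℝ (Fin 3)) :
    (fccSlots.filter fun w => ⟪G w, m⟫_ℝ < 0).card = (fccSlots.filter fun w => 0 < ⟪G w, m⟫_ℝ).card := by
  classical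
  have himg : (fccSlots.filter fun w => ⟪G w, m⟫_ℝ < 0) = (fccSlots.filter fun w => 0 < ⟪G w, m⟫_ℝ).image Neg.neg := by
    ext w
    simp only [Finset.mem_filter, Finset.mem_image]
    constructor
    · rintro ⟨hw, hlt⟩
      refine ⟨-w, ⟨neg_mem_fccSlots hw, ?_⟩, neg_neg w⟩
      rw [map_neg, inner_neg_left]; linarith
    · rintro ⟨u, ⟨hu, hpos⟩, rfl⟩
      refine ⟨neg_mem_fccSlots hu, ?_⟩
      rw [map_neg, inner_neg_left]; linarith
  rw [himg, Finset.card_image_of_injective _ neg_injective]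

/-- The closed lower half-shell and the open upper half-shell partition the twelve slots. -/
theorem card_twinNonpos_add_card_twinPos (G : EuclideanSpace ℝ (Fin 3) ≃ₗᵢ[ℝ] EuclideanSpace ℝ (Fin 3))
    (m : EuclideanSpace ℝ (Fin 3)) :
    (fccSlots.filter fun w => ⟪G w, m⟫_ℝ ≤ 0).card + (fccSlots.filter fun w => 0 < ⟪G w, m⟫_ℝ).card = 12 := by
  classical
  have h := Finset.card_filter_add_card_filter_not (s := fccSlots) (fun w => ⟪G w, m⟫_ℝ ≤ 0)
  rw [card_fccSlots] at h
  have he : (fccSlots.filter fun w => ¬⟪G w, m⟫_ℝ ≤ 0) = fccSlots.filter fun w => 0 < ⟪G w, m⟫_ℝ := by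
    ext w; simp only [Finset.mem_filter, not_le]
  rw [he] at h
  exact h

/-- The TWIN DOZEN of `(G, m)` at `b`: the closed lower half-shell `b + G w` (`⟪G w, m⟫ ≤ 0`) and the mirror images
`b + (G w − 2⟪G w, m⟫ m)` of the open lower half-shell, as one finset. -/
theorem mem_twinDozen_iff (G : EuclideanSpace ℝ (Fin 3) ≃ₗᵢ[ℝ] EuclideanSpace ℝ (Fin 3)) (m b x : EuclideanSpace ℝ (Fin 3)) :
    x ∈ ((fccSlots.filter fun w => ⟪G w, m⟫_ℝ ≤ 0).image fun w => b + G w) ∪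
        ((fccSlots.filter fun w => ⟪G w, m⟫_ℝ < 0).image fun w => b + (G w - (2 * ⟪G w, m⟫_ℝ) • m)) ↔
      (∃ w ∈ fccSlots, ⟪G w, m⟫_ℝ ≤ 0 ∧ x = b + G w) ∨
        ∃ w ∈ fccSlots, ⟪G w, m⟫_ℝ < 0 ∧ x = b + (G w - (2 * ⟪G w, m⟫_ℝ) • m) := by
  classical
  simp only [Finset.mem_union, Finset.mem_image, Finset.mem_filter, and_assoc, eq_comm (a := x)]

/-- **The twin dozen has twelve members** (for any unit `m`). -/
theorem card_twinDozen (G : EuclideanSpace ℝ (Fin 3) ≃ₗᵢ[ℝ] EuclideanSpace ℝ (Fin 3)) {m : EuclideanSpace ℝ (Fin 3)}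
    (hm : ‖m‖ = 1) (b : EuclideanSpace ℝ (Fin 3)) :
    (((fccSlots.filter fun w => ⟪G w, m⟫_ℝ ≤ 0).image fun w => b + G w) ∪
        ((fccSlots.filter fun w => ⟪G w, m⟫_ℝ < 0).image fun w => b + (G w - (2 * ⟪G w, m⟫_ℝ) • m))).card = 12 := by
  classical
  have hmm : ⟪m, m⟫_ℝ = 1 := by rw [real_inner_self_eq_norm_sq, hm, one_pow]
  -- the mirror image reads POSITIVE against `m`
  have hrefl : ∀ w, ⟪G w - (2 * ⟪G w, m⟫_ℝ) • m, m⟫_ℝ = -⟪G w, m⟫_ℝ := by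
    intro w; rw [inner_sub_left, inner_smul_left, hmm]; simp; ring
  rw [Finset.card_union_of_disjoint]
  · rw [Finset.card_image_of_injective _ (fun w w' h => G.injective (add_left_cancel h)),
      Finset.card_image_of_injOn, card_twinNeg_eq_card_twinPos, card_twinNonpos_add_card_twinPos]
    intro w _ w' _ h
    have h' : G w - (2 * ⟪G w, m⟫_ℝ) • m = G w' - (2 * ⟪G w', m⟫_ℝ) • m := add_left_cancel h
    have hi : ⟪G w, m⟫_ℝ = ⟪G w', m⟫_ℝ := by
      have := congrArg (fun u => ⟪u, m⟫_ℝ) h'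
      simp only [hrefl] at this
      linarith
    rw [hi] at h'
    exact G.injective (sub_left_injective h')
  · rw [Finset.disjoint_left]
    intro x hx hx'
    obtain ⟨w, hw, rfl⟩ := Finset.mem_image.1 hx
    obtain ⟨w', hw', he⟩ := Finset.mem_image.1 hx'
    have he' : G w' - (2 * ⟪G w', m⟫_ℝ) • m = G w := add_left_cancel he
    have := congrArg (fun u => ⟪u, m⟫_ℝ) he'
    simp only [hrefl] at this
    have h1 := (Finset.mem_filter.1 hw).2
    have h2 := (Finset.mem_filter.1 hw').2
    linarith

/-- **A TWIN-DOZEN reader is touched exactly by its twin dozen.** -/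
theorem contacts_eq_of_isTwinReading (hX : ∀ p ∈ X, ∀ q ∈ X, p ≠ q → 1 ≤ dist p q)
    {G : EuclideanSpace ℝ (Fin 3) ≃ₗᵢ[ℝ] EuclideanSpace ℝ (Fin 3)} {m b : EuclideanSpace ℝ (Fin 3)}
    (h : IsTwinReading X G m b) :
    (X.filter fun q => dist b q = 1) =
      ((fccSlots.filter fun w => ⟪G w, m⟫_ℝ ≤ 0).image fun w => b + G w) ∪
        ((fccSlots.filter fun w => ⟪G w, m⟫_ℝ < 0).image fun w => b + (G w - (2 * ⟪G w, m⟫_ℝ) • m)) := by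
  classical
  obtain ⟨⟨hm, -⟩, hlow, hmir, -⟩ := h
  symm
  apply Finset.eq_of_subset_of_card_le
  · intro x hx
    rcases (mem_twinDozen_iff G m b x).1 hx with ⟨w, hw, hle, rfl⟩ | ⟨w, hw, hlt, rfl⟩
    · refine Finset.mem_filter.2 ⟨hlow w hw hle, ?_⟩
      rw [dist_eq_norm, show b - (b + G w) = -(G w) by abel, norm_neg, LinearIsometryEquiv.norm_map,
        norm_eq_one_of_mem_fccSlots hw]
    · refine Finset.mem_filter.2 ⟨hmir w hw hlt, ?_⟩
      rw [dist_eq_norm, show b - (b + (G w - (2 * ⟪G w, m⟫_ℝ) • m)) = -(G w - (2 * ⟪G w, m⟫_ℝ) • m) by abel,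
        norm_neg, norm_reflectStep_slot G hm hw]
  · rw [card_twinDozen G hm]
    exact card_filter_dist_eq_one_le_twelve X hX b

/-- A TWIN-DOZEN reader has exactly twelve contacts. -/
theorem card_contacts_of_isTwinReading (hX : ∀ p ∈ X, ∀ q ∈ X, p ≠ q → 1 ≤ dist p q)
    {G : EuclideanSpace ℝ (Fin 3) ≃ₗᵢ[ℝ] EuclideanSpace ℝ (Fin 3)} {m b : EuclideanSpace ℝ (Fin 3)}
    (h : IsTwinReading X G m b) : (X.filter fun q => dist b q = 1).card = 12 := by
  rw [contacts_eq_of_isTwinReading hX h, card_twinDozen G h.1.1]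

/-- **No foreign contact at a TWIN-DOZEN reader**: every ball of `X` touching `b` is one of the twin dozen. -/
theorem mem_twinDozen_of_contact_of_isTwinReading (hX : ∀ p ∈ X, ∀ q ∈ X, p ≠ q → 1 ≤ dist p q)
    {G : EuclideanSpace ℝ (Fin 3) ≃ₗᵢ[ℝ] EuclideanSpace ℝ (Fin 3)} {m b : EuclideanSpace ℝ (Fin 3)}
    (h : IsTwinReading X G m b) {x : EuclideanSpace ℝ (Fin 3)} (hx : x ∈ X) (hd : dist b x = 1) :
    (∃ w ∈ fccSlots, ⟪G w, m⟫_ℝ ≤ 0 ∧ x = b + G w) ∨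
      ∃ w ∈ fccSlots, ⟪G w, m⟫_ℝ < 0 ∧ x = b + (G w - (2 * ⟪G w, m⟫_ℝ) • m) := by
  classical
  have hx' : x ∈ X.filter fun q => dist b q = 1 := Finset.mem_filter.2 ⟨hx, hd⟩
  rw [contacts_eq_of_isTwinReading hX h] at hx'
  exact (mem_twinDozen_iff G m b x).1 hx'

/-- A TWIN-DOZEN reader is not a payer. -/
theorem not_payer_of_isTwinReading (hX : ∀ p ∈ X, ∀ q ∈ X, p ≠ q → 1 ≤ dist p q)
    {G : EuclideanSpace ℝ (Fin 3) ≃ₗᵢ[ℝ] EuclideanSpace ℝ (Fin 3)} {m b : EuclideanSpace ℝ (Fin 3)}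
    (h : IsTwinReading X G m b) : ¬ (X.filter fun q => dist b q = 1).card ≤ 11 := by
  rw [card_contacts_of_isTwinReading hX h]; norm_num

end Summit.Ventures.Crystal3D.Theorems

end
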